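import Summits.QuantumFields.YangMills.Theorems.UnitScaleTiltHistoryTailOfPinnedHeightTail

/-!
# Crux `HistoryTailL` (stmt-QuantumFields-19936) — FILE K-19′: THE PINNED-HEIGHT-TAIL SOCKET WITH THE RATE AT A FREE PROFILE PER FAMILY AND COUPLING
# (★★OWNER WORDS 54 (2)(i) ∕ 56 «R-a′ letters, one socket»; px8 g11 ‼ (F2) «profile coupling»; LEAD seat ym-ust-19936-w1 g11, K-19 lineage)

Cell `ym3-torus` (YM ladder rung R3 = continuum SU(2) Yang–Mills on T³ — a RUNG, NOT the Clay problem: not d = 4, not infinite volume, not a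
mass gap).  Helper `--supports stmt-QuantumFields-19936`; THEOREMS ONLY, def-free.

WHY.  K-19 ✓`UnitScaleTiltHistoryTailOfPinnedHeightTail.historyTailL_of_pinnedHeightTail (hP)` — and through it the registered 19936 skeleton
`Cruxes/HistoryTailL/Lines/pinned_stability.lean` v2′ (stub `stub_pinnedStep`) — puts the EVENT's profile in the rate: `exp(−c·p_{b₀,p₀}(g_{K−j})²)`
for every profile `(b₀, p₀)` above the floors.  px8 g11's locate (F2): the typed (α) package carries ONE profile, and `p_{b₀,p₀}(g)²∕p_{𝔠}(g)² → ∞`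
as `g → 0` for steeper profiles, so the event-profile rate is true in print ((67)∕(70) are threshold-generic) but not derivable from the typed inputs
without a threshold-adaptive row; whereas the per-height arithmetic ✓`HistoryTailOfTwoSided.exists_perHeight_bound` is BLIND to the event profile —
it needs only `0 < b`, `1 ≤ p` OF THE RATE PROFILE and any `c > 0`.  Hence the weakest letter the socket accepts: the rate at the FLOORS
`(b₁', p₁')`, with `0 < b₁'`, `1 ≤ p₁'` exported (★★OWNER WORD 54 letter (R-a); = the conclusion of w8 g11's composite
`UV3PinnedStepFloorRateOfPurePin` one level up, modulo the Z-level door).  This file is K-19's proof VERBATIM with that one substitution.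
* ★★★ `historyTailL_of_pinnedHeightTail_freeRate (hP♭) : UnitScaleTilt.HistoryTailL`.
HONEST: route glue; `hP♭` (the pinned one-height large-field step at the floor rate, per volume) is OPEN; nothing of the cruxes, rung R3 or the
mass gap is proved here.
References: T. Bałaban, CMP 102 (1985) 255–275 [Balaban1985UV3] ((7) p.257, (41) p.266, (47) p.267, (67)/(70)–(71) p.273).
-/

set_option autoImplicit false

noncomputable section

open MeasureTheory Filter Topology
open Literature.MathematicalPhysics.QuantumFieldTheory.Balaban1983to89
open Literature.MathematicalPhysics.QuantumFieldTheory.Balaban1983to89.Missing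
open Literature.MathematicalPhysics.QuantumFieldTheory.Balaban1983to89.T4Continuum
open Literature.MathematicalPhysics.QuantumFieldTheory.Balaban1983to89.T3ContinuumYM3Torus
open Literature.MathematicalPhysics.QuantumFieldTheory.Balaban1983to89.T3UnitScaleTilt
open Literature.MathematicalPhysics.QuantumFieldTheory.Balaban1983to89.T3UnitLawDensityEML (ℰp measurableE_ℰp)
open Literature.MathematicalPhysics.QuantumFieldTheory.Balaban1983to89.T3BareTailProfile
open Summit.QuantumFields.YangMills.Theorems.HistoryTailOfTwoSided
open Summit.QuantumFields.YangMills.Theorems.PoincareLipschitzHistoryTailOfLinearTail (real_not_plaqSmall_inter_le_sum)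
open Summit.QuantumFields.YangMills.Theorems.PoincareLipschitzHistoryTailOfLinearTailDeep (historyTailAt_of_bare_finestBad_deep)

namespace Summit.QuantumFields.YangMills.Theorems.UnitScaleTiltHistoryTailOfPinnedHeightTailFreeRate

/-- ★★★ **`UnitScaleTilt.HistoryTailL` FROM THE PINNED HEIGHT TAIL AT A FREE RATE PROFILE.**  As ✓`historyTailL_of_pinnedHeightTail`, with the
rate profile `(b, p)` (`0 < b`, `1 ≤ p`) in the exponent chosen per family and coupling together with `C, c, A`, instead of the event's profile
`(b₀, p₀)`; ✓`exists_perHeight_bound` at `(b, p)`, everything else verbatim.  [cite: Balaban1985UV3, (7) p.257 and (70)-(71) p.273] -/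
theorem historyTailL_of_pinnedHeightTail_freeRate
    (hP : ∀ (L : ℕ), ∃ (b₁' p₁' : ℝ), ∀ (b₀ p₀ : ℝ), b₁' ≤ b₀ → p₁' ≤ p₀ → 0 < b₀ → 2 < p₀ → ∀ (m : ℕ), 0 < m →
      ∃ γ₁ : ℝ, 0 < γ₁ ∧ γ₁ ≤ 1 ∧ ∀ (F : T3Family) (γ : ℝ), F.L = L → 0 < γ → γ ≤ γ₁ →
        ∃ (b p C c : ℝ) (A : ℕ), 0 < b ∧ 1 ≤ p ∧ 0 ≤ C ∧ 0 < c ∧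
          ∀ (K j : ℕ), 1 ≤ j → j + 2 ≤ K → j + (K - 1) / m ≤ K → ∀ a : Plaq (F.P K) j,
          (gibbsK F ℰp γ K).real
              ({U : GaugeField (F.P K) 0 (Matrix.specialUnitaryGroup (Fin 2) ℂ) |
                  θBal F.L γ b₀ p₀ (K - j) ≤ GaugeGroup.dist1 (GaugeField.plaqHol
                    (Averaging.iter (fun i' => BlockAveraging.blockAvg (P := F.P K) (j := i') ℰp) j U) a)} ∩
                {U : GaugeField (F.P K) 0 (Matrix.specialUnitaryGroup (Fin 2) ℂ) | ∀ i, i < j →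
                  PlaqSmall (θBal F.L γ b₀ p₀ (K - i))
                    (Averaging.iter (fun i' => BlockAveraging.blockAvg (P := F.P K) (j := i') ℰp) i U)}) ≤
            C * (F.scheme ℰp γ).β (K - j) ^ A *
              Real.exp (-(c * B10.pFun b p (Real.sqrt (γ * ((F.L : ℝ)⁻¹) ^ (K - j))) ^ 2))) :
    Summit.QuantumFields.YangMills.Theses.UnitScaleTilt.HistoryTailL := by
  intro L b₁ p₁
  obtain ⟨b₁', p₁', H⟩ := hP L
  -- the profile above both floors, fixed BEFORE `m`
  obtain ⟨b₀, hb₁, hb₁'', hb₀1⟩ : ∃ b₀ : ℝ, b₁ ≤ b₀ ∧ b₁' ≤ b₀ ∧ 1 ≤ b₀ :=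
    ⟨max b₁ (max b₁' 1), le_max_left _ _, le_max_of_le_right (le_max_left _ _), le_max_of_le_right (le_max_right _ _)⟩
  obtain ⟨p₀, hp₁, hp₁'', hp₀⟩ : ∃ p₀ : ℝ, p₁ ≤ p₀ ∧ p₁' ≤ p₀ ∧ 2 < p₀ :=
    ⟨max p₁ (max p₁' 3), le_max_left _ _, le_max_of_le_right (le_max_left _ _),
      lt_of_lt_of_le (by norm_num) (le_max_of_le_right (le_max_right _ _))⟩
  have hb₀ : 0 < b₀ := one_pos.trans_le hb₀1
  have hp₀1 : 1 ≤ p₀ := by linarith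
  refine ⟨b₀, p₀, hb₁, hp₁, hb₀, hp₀, fun m hm => ?_⟩
  obtain ⟨γ₁, hγ₁, hγ₁1, HF⟩ := H b₀ p₀ hb₁'' hp₁'' hb₀ hp₀ m hm
  refine ⟨γ₁, hγ₁, fun F γ hFL hγ hγle => ?_⟩
  have hγ1 : γ ≤ 1 := hγle.trans hγ₁1
  -- the constants of THIS family and coupling
  obtain ⟨b, p, C, c, A, hb0, hp1, hC, hc, hb⟩ := HF F γ hFL hγ hγle
  -- the bare profile (landed: reflection positivity + chessboard) and the per-height constant (any `c > 0`, no threshold on `b₀`)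
  obtain ⟨q₀, hq₀0, hq₀, -, hbare⟩ := bareTailAt F hγ hγ1 hb₀ hp₀1
  obtain ⟨A', hA'0, hper⟩ := exists_perHeight_bound F hγ hγ1 hb0 hp1 hC A hc
  obtain ⟨hq0, hq, hqt⟩ := geometric_profile hA'0
  refine historyTailAt_of_bare_finestBad_deep F hγ.le b₀ p₀ hm q₀ (fun i => A' * ((1 : ℝ) / 2) ^ i)
    hq₀0 hq₀ hq0 hq hqt hbare fun K j hj1 hjK hjm => ?_
  -- one height: union over plaquettes, the pinned tail, the count, the arithmetic
  haveI := isProbabilityMeasure_gibbsK F ℰp hγ.le K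
  refine (real_not_plaqSmall_inter_le_sum (gibbsK F ℰp γ K)
    (Averaging.iter (fun i' => BlockAveraging.blockAvg (P := F.P K) (j := i') ℰp) j) (θBal F.L γ b₀ p₀ (K - j))
    {U | ∀ i, i < j → PlaqSmall (θBal F.L γ b₀ p₀ (K - i))
      (Averaging.iter (fun i' => BlockAveraging.blockAvg (P := F.P K) (j := i') ℰp) i U)}).trans ?_
  refine (Finset.sum_le_sum fun a _ => hb K j hj1 hjK hjm a).trans ?_
  rw [Finset.sum_const, Finset.card_univ, nsmul_eq_mul]
  have hcard := card_plaq_le_pow F (show j ≤ K by omega)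
  have hX : 0 ≤ C * (F.scheme ℰp γ).β (K - j) ^ A *
      Real.exp (-(c * B10.pFun b p (Real.sqrt (γ * ((F.L : ℝ)⁻¹) ^ (K - j))) ^ 2)) :=
    mul_nonneg (mul_nonneg hC (pow_nonneg (F.scheme_β_nonneg ℰp hγ.le (K - j)) A)) (Real.exp_nonneg _)
  calc (Fintype.card (Plaq (F.P K) j) : ℝ) * (C * (F.scheme ℰp γ).β (K - j) ^ A *
          Real.exp (-(c * B10.pFun b p (Real.sqrt (γ * ((F.L : ℝ)⁻¹) ^ (K - j))) ^ 2)))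
      ≤ (9 * (8 * (F.L : ℝ) ^ (3 * F.m) * ((F.L : ℝ) ^ (K - j)) ^ 3)) * (C * (F.scheme ℰp γ).β (K - j) ^ A *
          Real.exp (-(c * B10.pFun b p (Real.sqrt (γ * ((F.L : ℝ)⁻¹) ^ (K - j))) ^ 2))) :=
        mul_le_mul_of_nonneg_right hcard hX
    _ ≤ A' * ((1 : ℝ) / 2) ^ (K - j) := hper (K - j)

end Summit.QuantumFields.YangMills.Theorems.UnitScaleTiltHistoryTailOfPinnedHeightTailFreeRate

end
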